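import Summits.CriticalPhenomena.SAWScalingLimit.Theorems.SAWDevelopingMapObservableToSLEFloorPart
import Summits.CriticalPhenomena.SAWScalingLimit.Theorems.ObservableToSLE.Negative.TightnessNecessity
import HarnessLib

/-!
# Crux `SAWDevelopingMap.ObservableToSLE` (stmt-CriticalPhenomena-10472), line
`floor-ratio-restriction-bootstrap`: THE RESIDUE, AS KERNEL FACTS

Landing target:
`Summits/CriticalPhenomena/SAWScalingLimit/Theorems/SAWDevelopingMapObservableToSLEResidue.lean`
(`--supports stmt-CriticalPhenomena-10472`; continuation lead prover-line-stmt-CriticalPhenomena-10472-c2-0).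

The floor part of the line is LANDED (`stub_floorObservableToSLE_of_estimates`,
`stub_observableToSLE_of_estimates`, p114707): modulo the two lattice estimates HPAT (half-plane arch
tightness, registered stub `stub_halfPlaneArchTightness`) and UIM (uniform injectivity modulus, registered
stub `stub_uniformModulus`) the crux hypothesis gives chordal SLE(8/3) convergence on the FLOOR CLASS
(Jordan domain above the horizontal line through its two marked points, flat radius-`ρ` half-discs at both,
floor-vertex endpoints).  This file records, sorry-free and over tree vocabulary only, what is then LEFT of
the crux — the pure logic the three leads' verdict rests on:

* `stub_domainExtension_of_observableToSLE` — the extension stub W2 (`stub_domainExtension`: floor-class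
  identification ⟹ identification for every Dobrushin domain and every `IsEmbEndpointApprox`) is implied by
  the crux, unconditionally;
* `stub_domainExtension_iff_observableToSLE_of_estimates` — modulo HPAT and UIM, W2 is EQUIVALENT to the
  crux: it is the crux itself restricted off the floor class (concrete form of Disproof.lean §6
  `extension_iff_crux_of_floor`, now with the floor part a theorem);
* `stub_observableToSLE_of_floor_of_boundaryUniversality` — the planners' restatement closes the original:
  the crux NARROWED to the floor class (C′, `FloorObservableToSLE`: `HexObservableLimit → HexTight → floor
  convergence`) and the boundary-class / endpoint universality step (E, `BoundaryUniversality`: floor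
  convergence ⟹ DCS Conjecture 1 as typed, `HexConjecture`) give `ObservableToSLE` by a two-line glue;
* `stub_boundaryUniversality_of_hexConjecture` — (E) is implied by DCS Conjecture 1 (so it is not refutable
  short of refuting Conjecture 1), and `stub_boundaryUniversality_iff_hexConjecture_of_estimates` — modulo
  HPAT, UIM and the two route hypotheses, (E) is EQUIVALENT to Conjecture 1: the hypothesis
  `HexObservableLimit` (rev 4: both marked points pinned to flat horizontal half-lattice pieces) has nothing
  left to say there (`Negative.flat_premise_false_on_unitDisc`, OrientationSilence p77126).
-/

noncomputable section

open scoped BigOperators Topology NNReal ENNReal Classical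
open Filter Set MeasureTheory Metric
open Literature.Probability.LatticeModels (HexVertex hexGraph hexCenter)
open Literature.Probability.RandomPlanarGeometry
open Literature.Probability.RandomPlanarGeometry.SAW
open UpperHalfPlane (upperHalfPlaneSet)

namespace Summit.CriticalPhenomena.SAWScalingLimit.Theorems.ObservableToSLE.FloorRatio

open Summit.CriticalPhenomena.SAWScalingLimit.Theses.SAWDevelopingMap
  (HexObservableLimit HexTight ObservableToSLE HexConjecture)
open Summit.CriticalPhenomena.SAWScalingLimit.Theorems.ObservableToSLE.Negative
  (observableToSLE_iff_identification)

/-- **W2 is implied by the crux** (registered sub-goal `stub_domainExtension_of_observableToSLE`): the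
registered extension stub `stub_domainExtension` — `HexObservableLimit → HexTight →` (identification on
the floor class) `→` (identification for every Dobrushin domain and endpoint approximation) — follows from
`ObservableToSLE` by the landed `Negative.observableToSLE_iff_identification` (p69742), ignoring the floor
premise. [cite: DuminilCopinSmirnov2012, Conjecture 1 (arXiv:1007.0575 p. 7)] -/
theorem stub_domainExtension_of_observableToSLE :
    ObservableToSLE →
    HexObservableLimit → HexTight →
    (∀ (D : DobrushinDomain) (ρ : ℝ) (a b : ℝ → HexVertex),
    (0 < ρ ∧ (D.pt 1).im = (D.pt 0).im ∧ D.carrier ⊆ {z : ℂ | (D.pt 0).im < z.im} ∧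
    D.carrier ∩ ball (D.pt 0) ρ = {z : ℂ | (D.pt 0).im < z.im} ∩ ball (D.pt 0) ρ ∧
    D.carrier ∩ ball (D.pt 1) ρ = {z : ℂ | (D.pt 1).im < z.im} ∩ ball (D.pt 1) ρ) →
    (IsEmbEndpointApprox hexGraph hexCenter D a b ∧ ∀ᶠ δ : ℝ in 𝓝[>] 0,
    (∃ u : HexVertex, hexGraph.Adj (a δ) u ∧ ((δ : ℂ) * hexCenter u).im ≤ (D.pt 0).im) ∧
    (∃ u : HexVertex, hexGraph.Adj (b δ) u ∧ ((δ : ℂ) * hexCenter u).im ≤ (D.pt 1).im)) →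
    ∀ μ : Measure (CurveClass ℂ), IsProbabilityMeasure μ →
    IsSubseqLimitLaw (fun δ (γ : HexDomainSAW D.carrier δ (a δ) (b δ)) => γ.curve)
    (fun δ => hexSAWLaw D.carrier δ (a δ) (b δ)) μ →
    IsSLELaw ((8 : ℝ≥0) / 3) D μ) →
    ∀ (D : DobrushinDomain) (a b : ℝ → HexVertex),
    IsEmbEndpointApprox hexGraph hexCenter D a b →
    ∀ μ : Measure (CurveClass ℂ), IsProbabilityMeasure μ →
    IsSubseqLimitLaw (fun δ (γ : HexDomainSAW D.carrier δ (a δ) (b δ)) => γ.curve)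
    (fun δ => hexSAWLaw D.carrier δ (a δ) (b δ)) μ →
    IsSLELaw ((8 : ℝ≥0) / 3) D μ := by
  intro h hO hT _
  exact observableToSLE_iff_identification.mp h hO hT

/-- **Modulo the two estimates, W2 IS the crux** (registered sub-goal
`stub_domainExtension_iff_observableToSLE_of_estimates`): half-plane arch tightness → uniform injectivity
modulus → (`stub_domainExtension`'s statement ↔ `ObservableToSLE`).  (→) is the landed
`stub_observableToSLE_of_estimates` (p114707); (←) is `stub_domainExtension_of_observableToSLE`.  Concrete
form of Disproof.lean §6 `extension_iff_crux_of_floor` with the floor part now a theorem.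
[cite: DuminilCopinSmirnov2012, Conjecture 1 (arXiv:1007.0575 p. 7); LawlerSchrammWerner2003Restriction, Thm. 6.1] -/
theorem stub_domainExtension_iff_observableToSLE_of_estimates :
    (∀ ε : ℝ, 0 < ε → ∃ K : ℝ, 0 < K ∧ ∀ (n : ℕ), 1 ≤ n → ∀ (Λ B : Finset HexVertex)
      (s t : Sym2 HexVertex), s ∈ hexDomainBoundary Λ → t ∈ hexDomainBoundary Λ → s ≠ t →
      dist (hexMidpoint s) (hexMidpoint t) ≤ n → (hexMidpoint t).im = (hexMidpoint s).im →
      (∀ v ∈ Λ, (hexMidpoint s).im < (hexCenter v).im) →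
      (∀ v : HexVertex, v ∈ B ↔ ((hexMidpoint s).im < (hexCenter v).im ∧
        dist (hexCenter v) (hexMidpoint s) ≤ 2 * K * n)) →
      (∑ γ : HexMidEdgeSAW Λ s t, if ∃ v ∈ γ.verts, K * n ≤ dist (hexCenter v) (hexMidpoint s)
        then hexCriticalFugacity ^ γ.length else 0) ≤
      ε * ∑ γ : HexMidEdgeSAW B s t, hexCriticalFugacity ^ γ.length) →
    (∀ (D : DobrushinDomain) (ρ : ℝ) (a b : ℝ → HexVertex),
      (0 < ρ ∧ (D.pt 1).im = (D.pt 0).im ∧ D.carrier ⊆ {z : ℂ | (D.pt 0).im < z.im} ∧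
      D.carrier ∩ ball (D.pt 0) ρ = {z : ℂ | (D.pt 0).im < z.im} ∩ ball (D.pt 0) ρ ∧
      D.carrier ∩ ball (D.pt 1) ρ = {z : ℂ | (D.pt 1).im < z.im} ∩ ball (D.pt 1) ρ) →
      (IsEmbEndpointApprox hexGraph hexCenter D a b ∧ ∀ᶠ δ : ℝ in 𝓝[>] 0,
      (∃ u : HexVertex, hexGraph.Adj (a δ) u ∧ ((δ : ℂ) * hexCenter u).im ≤ (D.pt 0).im) ∧
      (∃ u : HexVertex, hexGraph.Adj (b δ) u ∧ ((δ : ℂ) * hexCenter u).im ≤ (D.pt 1).im)) →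
      ∀ ε η : ℝ, 0 < ε → 0 < η → ∃ θ : ℝ, 0 < θ ∧ ∀ᶠ δ : ℝ in 𝓝[>] 0,
        hexSAWLaw D.carrier δ (a δ) (b δ) {γ | γ.curve ∉ CurveClass.modulusClass ε θ} ≤
          ENNReal.ofReal η) →
    ((HexObservableLimit → HexTight →
    (∀ (D : DobrushinDomain) (ρ : ℝ) (a b : ℝ → HexVertex),
    (0 < ρ ∧ (D.pt 1).im = (D.pt 0).im ∧ D.carrier ⊆ {z : ℂ | (D.pt 0).im < z.im} ∧
    D.carrier ∩ ball (D.pt 0) ρ = {z : ℂ | (D.pt 0).im < z.im} ∩ ball (D.pt 0) ρ ∧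
    D.carrier ∩ ball (D.pt 1) ρ = {z : ℂ | (D.pt 1).im < z.im} ∩ ball (D.pt 1) ρ) →
    (IsEmbEndpointApprox hexGraph hexCenter D a b ∧ ∀ᶠ δ : ℝ in 𝓝[>] 0,
    (∃ u : HexVertex, hexGraph.Adj (a δ) u ∧ ((δ : ℂ) * hexCenter u).im ≤ (D.pt 0).im) ∧
    (∃ u : HexVertex, hexGraph.Adj (b δ) u ∧ ((δ : ℂ) * hexCenter u).im ≤ (D.pt 1).im)) →
    ∀ μ : Measure (CurveClass ℂ), IsProbabilityMeasure μ →
    IsSubseqLimitLaw (fun δ (γ : HexDomainSAW D.carrier δ (a δ) (b δ)) => γ.curve)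
    (fun δ => hexSAWLaw D.carrier δ (a δ) (b δ)) μ →
    IsSLELaw ((8 : ℝ≥0) / 3) D μ) →
    ∀ (D : DobrushinDomain) (a b : ℝ → HexVertex),
    IsEmbEndpointApprox hexGraph hexCenter D a b →
    ∀ μ : Measure (CurveClass ℂ), IsProbabilityMeasure μ →
    IsSubseqLimitLaw (fun δ (γ : HexDomainSAW D.carrier δ (a δ) (b δ)) => γ.curve)
    (fun δ => hexSAWLaw D.carrier δ (a δ) (b δ)) μ →
    IsSLELaw ((8 : ℝ≥0) / 3) D μ) ↔ ObservableToSLE) := by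
  intro hHPAT hUIM
  exact ⟨fun hExt => stub_observableToSLE_of_estimates hHPAT hUIM hExt,
    fun h => stub_domainExtension_of_observableToSLE h⟩

/-- **The planners' restatement closes the original crux** (registered sub-goal
`stub_observableToSLE_of_floor_of_boundaryUniversality`).  (C′) the crux NARROWED to the class its
hypothesis binds — `HexObservableLimit → HexTight →` chordal SLE(8/3) convergence of `hexSAWLaw` for every
FLOOR Dobrushin domain and floor-vertex endpoint approximation (a theorem modulo HPAT and UIM:
`stub_floorObservableToSLE_of_estimates`, p114707) — and (E) BOUNDARY UNIVERSALITY — floor convergence ⟹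
DCS Conjecture 1 as typed (`HexConjecture`, stmt-CriticalPhenomena-0808) — give `ObservableToSLE` by name.
[cite: DuminilCopinSmirnov2012, Conjecture 1 (arXiv:1007.0575 p. 7)] -/
theorem stub_observableToSLE_of_floor_of_boundaryUniversality :
    (HexObservableLimit → HexTight →
    ∀ (D : DobrushinDomain) (ρ : ℝ) (a b : ℝ → HexVertex),
    (0 < ρ ∧ (D.pt 1).im = (D.pt 0).im ∧ D.carrier ⊆ {z : ℂ | (D.pt 0).im < z.im} ∧
    D.carrier ∩ ball (D.pt 0) ρ = {z : ℂ | (D.pt 0).im < z.im} ∩ ball (D.pt 0) ρ ∧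
    D.carrier ∩ ball (D.pt 1) ρ = {z : ℂ | (D.pt 1).im < z.im} ∩ ball (D.pt 1) ρ) →
    (IsEmbEndpointApprox hexGraph hexCenter D a b ∧ ∀ᶠ δ : ℝ in 𝓝[>] 0,
    (∃ u : HexVertex, hexGraph.Adj (a δ) u ∧ ((δ : ℂ) * hexCenter u).im ≤ (D.pt 0).im) ∧
    (∃ u : HexVertex, hexGraph.Adj (b δ) u ∧ ((δ : ℂ) * hexCenter u).im ≤ (D.pt 1).im)) →
    ConvergesInLawToSLE ((8 : ℝ≥0) / 3) D
      (fun δ (γ : HexDomainSAW D.carrier δ (a δ) (b δ)) => γ.curve)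
      (fun δ => hexSAWLaw D.carrier δ (a δ) (b δ))) →
    ((∀ (D : DobrushinDomain) (ρ : ℝ) (a b : ℝ → HexVertex),
    (0 < ρ ∧ (D.pt 1).im = (D.pt 0).im ∧ D.carrier ⊆ {z : ℂ | (D.pt 0).im < z.im} ∧
    D.carrier ∩ ball (D.pt 0) ρ = {z : ℂ | (D.pt 0).im < z.im} ∩ ball (D.pt 0) ρ ∧
    D.carrier ∩ ball (D.pt 1) ρ = {z : ℂ | (D.pt 1).im < z.im} ∩ ball (D.pt 1) ρ) →
    (IsEmbEndpointApprox hexGraph hexCenter D a b ∧ ∀ᶠ δ : ℝ in 𝓝[>] 0,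
    (∃ u : HexVertex, hexGraph.Adj (a δ) u ∧ ((δ : ℂ) * hexCenter u).im ≤ (D.pt 0).im) ∧
    (∃ u : HexVertex, hexGraph.Adj (b δ) u ∧ ((δ : ℂ) * hexCenter u).im ≤ (D.pt 1).im)) →
    ConvergesInLawToSLE ((8 : ℝ≥0) / 3) D
      (fun δ (γ : HexDomainSAW D.carrier δ (a δ) (b δ)) => γ.curve)
      (fun δ => hexSAWLaw D.carrier δ (a δ) (b δ))) → HexConjecture) →
    ObservableToSLE := by
  intro hC hE hO hT
  exact hE (hC hO hT)

/-- **(E) is implied by DCS Conjecture 1** (registered sub-goal `stub_boundaryUniversality_of_hexConjecture`):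
boundary universality, being an implication with conclusion `HexConjecture`, cannot be refuted short of
refuting Conjecture 1 itself. [cite: DuminilCopinSmirnov2012, Conjecture 1 (arXiv:1007.0575 p. 7)] -/
theorem stub_boundaryUniversality_of_hexConjecture :
    HexConjecture →
    ((∀ (D : DobrushinDomain) (ρ : ℝ) (a b : ℝ → HexVertex),
    (0 < ρ ∧ (D.pt 1).im = (D.pt 0).im ∧ D.carrier ⊆ {z : ℂ | (D.pt 0).im < z.im} ∧
    D.carrier ∩ ball (D.pt 0) ρ = {z : ℂ | (D.pt 0).im < z.im} ∩ ball (D.pt 0) ρ ∧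
    D.carrier ∩ ball (D.pt 1) ρ = {z : ℂ | (D.pt 1).im < z.im} ∩ ball (D.pt 1) ρ) →
    (IsEmbEndpointApprox hexGraph hexCenter D a b ∧ ∀ᶠ δ : ℝ in 𝓝[>] 0,
    (∃ u : HexVertex, hexGraph.Adj (a δ) u ∧ ((δ : ℂ) * hexCenter u).im ≤ (D.pt 0).im) ∧
    (∃ u : HexVertex, hexGraph.Adj (b δ) u ∧ ((δ : ℂ) * hexCenter u).im ≤ (D.pt 1).im)) →
    ConvergesInLawToSLE ((8 : ℝ≥0) / 3) D
      (fun δ (γ : HexDomainSAW D.carrier δ (a δ) (b δ)) => γ.curve)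
      (fun δ => hexSAWLaw D.carrier δ (a δ) (b δ))) → HexConjecture) :=
  fun h _ => h

/-- **Modulo the two estimates and the two route hypotheses, (E) IS Conjecture 1** (registered sub-goal
`stub_boundaryUniversality_iff_hexConjecture_of_estimates`): half-plane arch tightness → uniform
injectivity modulus → `HexObservableLimit` → `HexTight` → (boundary universality ↔ `HexConjecture`).
The floor premise of (E) is then a theorem (`stub_floorObservableToSLE_of_estimates`, p114707), so (E)
carries exactly the content of Conjecture 1 off the floor class — the typed reason no line built on the
rev-4 `HexObservableLimit` reaches it. [cite: DuminilCopinSmirnov2012, Conjecture 1 (arXiv:1007.0575 p. 7)] -/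
theorem stub_boundaryUniversality_iff_hexConjecture_of_estimates :
    (∀ ε : ℝ, 0 < ε → ∃ K : ℝ, 0 < K ∧ ∀ (n : ℕ), 1 ≤ n → ∀ (Λ B : Finset HexVertex)
      (s t : Sym2 HexVertex), s ∈ hexDomainBoundary Λ → t ∈ hexDomainBoundary Λ → s ≠ t →
      dist (hexMidpoint s) (hexMidpoint t) ≤ n → (hexMidpoint t).im = (hexMidpoint s).im →
      (∀ v ∈ Λ, (hexMidpoint s).im < (hexCenter v).im) →
      (∀ v : HexVertex, v ∈ B ↔ ((hexMidpoint s).im < (hexCenter v).im ∧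
        dist (hexCenter v) (hexMidpoint s) ≤ 2 * K * n)) →
      (∑ γ : HexMidEdgeSAW Λ s t, if ∃ v ∈ γ.verts, K * n ≤ dist (hexCenter v) (hexMidpoint s)
        then hexCriticalFugacity ^ γ.length else 0) ≤
      ε * ∑ γ : HexMidEdgeSAW B s t, hexCriticalFugacity ^ γ.length) →
    (∀ (D : DobrushinDomain) (ρ : ℝ) (a b : ℝ → HexVertex),
      (0 < ρ ∧ (D.pt 1).im = (D.pt 0).im ∧ D.carrier ⊆ {z : ℂ | (D.pt 0).im < z.im} ∧
      D.carrier ∩ ball (D.pt 0) ρ = {z : ℂ | (D.pt 0).im < z.im} ∩ ball (D.pt 0) ρ ∧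
      D.carrier ∩ ball (D.pt 1) ρ = {z : ℂ | (D.pt 1).im < z.im} ∩ ball (D.pt 1) ρ) →
      (IsEmbEndpointApprox hexGraph hexCenter D a b ∧ ∀ᶠ δ : ℝ in 𝓝[>] 0,
      (∃ u : HexVertex, hexGraph.Adj (a δ) u ∧ ((δ : ℂ) * hexCenter u).im ≤ (D.pt 0).im) ∧
      (∃ u : HexVertex, hexGraph.Adj (b δ) u ∧ ((δ : ℂ) * hexCenter u).im ≤ (D.pt 1).im)) →
      ∀ ε η : ℝ, 0 < ε → 0 < η → ∃ θ : ℝ, 0 < θ ∧ ∀ᶠ δ : ℝ in 𝓝[>] 0,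
        hexSAWLaw D.carrier δ (a δ) (b δ) {γ | γ.curve ∉ CurveClass.modulusClass ε θ} ≤
          ENNReal.ofReal η) →
    HexObservableLimit → HexTight →
    (((∀ (D : DobrushinDomain) (ρ : ℝ) (a b : ℝ → HexVertex),
    (0 < ρ ∧ (D.pt 1).im = (D.pt 0).im ∧ D.carrier ⊆ {z : ℂ | (D.pt 0).im < z.im} ∧
    D.carrier ∩ ball (D.pt 0) ρ = {z : ℂ | (D.pt 0).im < z.im} ∩ ball (D.pt 0) ρ ∧
    D.carrier ∩ ball (D.pt 1) ρ = {z : ℂ | (D.pt 1).im < z.im} ∩ ball (D.pt 1) ρ) →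
    (IsEmbEndpointApprox hexGraph hexCenter D a b ∧ ∀ᶠ δ : ℝ in 𝓝[>] 0,
    (∃ u : HexVertex, hexGraph.Adj (a δ) u ∧ ((δ : ℂ) * hexCenter u).im ≤ (D.pt 0).im) ∧
    (∃ u : HexVertex, hexGraph.Adj (b δ) u ∧ ((δ : ℂ) * hexCenter u).im ≤ (D.pt 1).im)) →
    ConvergesInLawToSLE ((8 : ℝ≥0) / 3) D
      (fun δ (γ : HexDomainSAW D.carrier δ (a δ) (b δ)) => γ.curve)
      (fun δ => hexSAWLaw D.carrier δ (a δ) (b δ))) → HexConjecture) ↔ HexConjecture) := by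
  intro hHPAT hUIM hO hT
  exact ⟨fun hE => hE (stub_floorObservableToSLE_of_estimates hHPAT hUIM hO hT),
    fun h _ => h⟩

end Summit.CriticalPhenomena.SAWScalingLimit.Theorems.ObservableToSLE.FloorRatio

end
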